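import Summits.ABC.IUTFork.LDHCor312Primes
import Summits.ABC.IUTFork.LDHWitness
import HarnessLib

/-!
# FACT-LIST SCHEMA row F-2280 `DHData.HullSupportedOn` — ∀-closure REFUTED, instance INHABITED (valuation line over `ℚ`)

PROOF-ONLY companion (0 `def`, 0 `instance`, 0 notation) of the abc-iut cell, block F (seat abc-iut-f-135, gen 8;
director-abc g4 ROW SUPPLY `ROWS-LF-0348.tsv` row 82 «decide the label»; abc-iut-f-130 g7 residual census). It imports —
never edits — c312-3's `LDHCor312Primes` (`DHData.HullSupportedOn T₀`: "off the finite set `T₀`, every component of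
`hull(U_Θ)` at a prime has normalised log-measure `0`" — the support hypothesis of [IUTchIV] Prop. 1.4 (iv) / Thm. 1.10
Step (vi), "an OBLIGATION of the concrete model … not assumed by any declaration") and c312-3's vacuity-audit witnesses
`LDHWitness` over the valuation line (`ValLine.shellWitness`, `ValLine.bareWitness`, `ValLine.exists_pilotData_rat`).

* `ValLine.hullSupportedOn_shellWitness` — witness A (`(O_𝕃(−P_Θ))^{Ind3} = O`, hull `= O`): the hull is supported on
  EVERY `T₀` (even `∅`), over any number field and any pilot data — INHABITED.
* `ValLine.not_hullSupportedOn_bareWitness_empty` — witness B (no (Ind3) enlargement) over pilot data with one place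
  over each prime under `S` (e.g. `ℚ`): the hull is NOT supported on `∅` — else the truncations of (1.1) would
  stabilise at `T' = ∅`, where the theta side is the empty sum `0 ≥ −deĝ̲(P_q)`, giving (1.1) for witness B, which
  c312-3 REFUTED (`not_cor312DH_bareWitness`).
* `not_forall_hullSupportedOn` / `exists_hullSupportedOn` — the ∀-closure of the schema over its free signature
  `(F, D, T₀)` is REFUTED and the schema is INHABITED: the row's content is per-datum (which `T₀` a given model supports
  the hull on — c312-3's `hullSupportedOn_of_shell` for the tensor-packet route, by name).

HONEST FRAMING: toy certificates over the valuation line (trivial (Ind2), identity (Ind1)-transport); nothing here bears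
on the real tensor-packet containers, on Dupuy–Hilado's (1.1), or on [IUTchIII] Cor. 3.12 / [IUTchIV] Thm. 1.10, and no
side is taken on any author. A FACT row is an assumption label on OUR typed statement; typed ≠ proved.
[cite: Mochizuki2012, IUTchIV Prop. 1.4 (iv) p. 13] [cite: DupuyHilado2025, §1 (1.1), Def. 3.6.3]
-/

noncomputable section

open Set Finset

namespace Summit.ABC.IUTFork

open Literature.IUT.LogVolume NumberField IsDedekindDomain

namespace ValLine

variable {F : Type} [Field F] [NumberField F] (X : PilotData F)

/-- **Witness A supports its hull everywhere**: with `(O_𝕃(−P_Θ))^{Ind3} = O` the hull is `O` in every summand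
(`hullUTheta_shell`), whose normalised log-measure is `0` — so `HullSupportedOn T₀` for EVERY `T₀`.
[cite: DupuyHilado2025, §4.10–4.12] -/
theorem hullSupportedOn_shellWitness (T₀ : Finset ℕ) : (shellWitness X).HullSupportedOn T₀ := by
  intro p _ _ j e
  show (valLine F).logμ ((valLine F).hullUTheta (ind3Shell X) p j e) = 0
  rw [hullUTheta_shell]
  exact (valLine F).logμ_O p j e

/-- **Witness B does NOT support its hull on `∅`** (one place over each prime under `S`): if it did, the truncations
of (1.1) would all agree with the one over `T' = ∅` (`cor312DHOn_iff_of_hullSupportedOn`), whose theta side is the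
empty sum `0 ≥ −deĝ̲(P_q)`; so (1.1) would hold for witness B — but c312-3 proved it FAILS
(`not_cor312DH_bareWitness`). [cite: DupuyHilado2025, §1 (1.1), Def. 3.6.3] [claim: Mochizuki2012, status: disputed] -/
theorem not_hullSupportedOn_bareWitness_empty (h : ∀ p ∈ primesUnder X, ∀ v w : placesOver F p, v = w) :
    ¬ (bareWitness X).HullSupportedOn ∅ := by
  intro hS
  apply not_cor312DH_bareWitness X h
  -- (1.1) over `T' = ∅`: the theta side is the empty sum
  have h0 : (bareWitness X).Cor312DHOn ∅ := by
    show -FinDivisor.ndeg F (bareWitness X).X.qPilot ≤ (bareWitness X).negLogThetaDHOn ∅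
    rw [DHData.negLogThetaDHOn, PacketModel.lnνL, Finset.sum_empty, neg_nonpos, FinDivisor.ndeg_apply]
    exact div_nonneg X.deg_qPilot_pos.le FinDivisor.finrank_pos.le
  -- stabilisation under the support hypothesis transports it to `T`
  exact ((bareWitness X).cor312DHOn_iff_of_hullSupportedOn hS (Finset.empty_subset _)
    (bareWitness X).T_prime).mpr h0

end ValLine

/-! ## The schema row F-2280 -/

/-- **F-2280, ∀-closure REFUTED**: `DHData.HullSupportedOn D T₀` is not a theorem of its free signature `(F, D, T₀)` —
witness B over `ℚ` (c312-3's `exists_pilotData_rat`: `j_E = 1/5`, `S` = the place over `5`, `l = 5`) at `T₀ = ∅`.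
[cite: Mochizuki2012, IUTchIV Prop. 1.4 (iv) p. 13] -/
theorem not_forall_hullSupportedOn :
    ¬ ∀ (F : Type) [Field F] [NumberField F] (D : DHData F) (T₀ : Finset ℕ), D.HullSupportedOn T₀ := by
  intro hall
  obtain ⟨X, hX⟩ := ValLine.exists_pilotData_rat
  exact ValLine.not_hullSupportedOn_bareWitness_empty X hX (hall ℚ (ValLine.bareWitness X) ∅)

/-- **F-2280, INHABITED**: witness A over `ℚ` supports its hull on `∅` (indeed on every `T₀`,
`ValLine.hullSupportedOn_shellWitness`). [cite: Mochizuki2012, IUTchIV Prop. 1.4 (iv) p. 13] -/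
theorem exists_hullSupportedOn :
    ∃ (F : Type) (_ : Field F) (_ : NumberField F) (D : DHData F) (T₀ : Finset ℕ), D.HullSupportedOn T₀ := by
  obtain ⟨X, -⟩ := ValLine.exists_pilotData_rat
  exact ⟨ℚ, inferInstance, inferInstance, ValLine.shellWitness X, ∅, ValLine.hullSupportedOn_shellWitness X ∅⟩

end Summit.ABC.IUTFork

end
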